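import Literature.NumberTheory.Automorphic.GL2SplitTorusOrbitalVanishing
import Literature.NumberTheory.Automorphic.LocalFieldHaarBalls
import Literature.NumberTheory.Automorphic.OrbitalIntegralCentralTransport
import Literature.MeasureTheory.Group.InvariantQuotientCompactOpenMass
import Mathlib.MeasureTheory.Measure.WithDensity
import HarnessLib

/-!
# The split-torus orbital integrals of `GL₂(F)`: `Φ(d(m₀,m₁), f) = C ‖m₀⁻¹m₁ − 1‖⁻¹ ∫_K ∫_F f(k d n(x) k⁻¹)`
# and `Φ(d(m₀,m₁), 1_K) = vol(K) ∕ (vol(A ∩ K) ‖m₀ − m₁‖)` for units `m₀ ≠ m₁`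
(Rogawski, *Automorphic representations of unitary groups in three variables* (1990), §4.13,
Lemma 4.13.1 (a) and its proof pp. 69–70; Gelbart, *Automorphic forms on adele groups* (1975),
Remark 9.23 «`∫_{A\G} = ∫_N ∫_K`»; Laumon (1996), (4.3.11))

Topic `NumberTheory/Automorphic`; namespace `Literature.NumberTheory.Automorphic`. THEOREMS ONLY (no
definition, no instance, no named fact, no `sorry`). Road «D-S1» at `n = 2`: the parabolic descent
of orbital integrals on `G = GL₂(F)` (`F` a non-archimedean local field) at a REGULAR element
`γ = d(m₀, m₁)` (`m₀ ≠ m₁`) of the diagonal torus `A = C_G(γ)` (★ `GL2.mem_centralizer_diagGL2_iff`), in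
the GL₂ dress already used by ★ `GL2SplitTorusOrbitalVanishing`: the `K N A` form of an invariant
measure on `G ⧸ A` (★ `KNAQuotientIntegration.exists_measure_quotient_eq_smul_map`,
`μ_q = C · ((k, n) ↦ k n A)_* (κ ⊗ n_* dx)`, `K = GL₂(𝒪)`, `N = N₂`), the conjugation formula
★ `GL2.unipotentGL2_mul_diagGL2_mul_inv` (`n(x) γ n(x)⁻¹ = γ n(c x)`, `c = m₀⁻¹ m₁ − 1 ≠ 0`) and the
Jacobian ★ `map_mul_left_addHaar` (`(x ↦ c x)_* dx = ‖c‖⁻¹ dx`):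

* §1 algebra in `GL₂(𝒪)`: `GL2.unipotentGL2_mem_glInt_iff` (`n(x) ∈ K ↔ x ∈ 𝒪`),
  `GL2.diagGL2_mem_glInt` (units), `GL2.exists_glInt_centralizer_eq_unipotentGL2_iff`
  (`n(x) ∈ K·A ↔ x ∈ 𝒪`), `GL2.normAbs_inv_mul_sub_one` (`‖m₀⁻¹ m₁ − 1‖ = ‖m₀ − m₁‖` for a unit `m₀`).
* §2 **(g2-i) `GL2.exists_orbitalIntegral_diagGL2_eq_smul_integral`** — for a non-zero `G`-invariant
  Radon measure `μ_q` on `G ⧸ A`, a Haar measure `κ` on `K` and an additive Haar measure `dx` on `F`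
  there is ONE `C > 0` with, for every continuous compactly supported `f : G → E`,
  `O_γ^{μ_q}(f) = C ‖m₀⁻¹ m₁ − 1‖⁻¹ ∫_{K × F} f(k γ n(x) k⁻¹) d(κ ⊗ dx)`
  (print: `Φ^G(γ, f) = |D_{G/A}(γ)|^{-1/2} Φ^A(γ, f̄^P)`; here `‖m₀⁻¹m₁ − 1‖⁻¹ = ‖m₀‖∕‖m₀ − m₁‖ =
  |D_{G/A}(γ)|^{-1/2} δ_B(γ)^{1/2}`, the `u`-variable sitting to the RIGHT of `γ`), AND the SAME `C` is
  PINNED by the mass of `π(K)`: **`C · κ(K) · dx(𝒪) = μ_q(π(K))`** (`π(K)` pulls back to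
  `K × {n | n ∈ K·A} = K × n(𝒪)` in the `K N` coordinates).
* §3 **(g2-ii) the unit element**: for `m₀, m₁ ∈ 𝒪ˣ`, `m₀ ≠ m₁`, and the quotient measure
  `ν/t = quotientMeasure A t ν` (★ `InvariantQuotientCompactOpenMass`: `(ν/t)(π K) = ν(K)∕t(A ∩ K)`):
  **`O_γ^{ν/t}(1_K) = (ν(K) ∕ t(A ∩ K)) · ‖m₀ − m₁‖⁻¹`**
  (`GL2.orbitalIntegral_indicator_glInt_diagGL2_quotientMeasure`), `= ‖m₀ − m₁‖⁻¹` at `ν(K) = t(A ∩ K) = 1`;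
  for a general invariant `μ_q`: `O_γ^{μ_q}(1_K) = μ_q(π K) · ‖m₀ − m₁‖⁻¹`.
* §4 **(g2-iii) the central element**: `O_z^{ν/t}(1_K) = 1` for scalar `z ∈ K` at `ν(K) = t(K) = 1`
  — ★ A-p13 `orbitalIntegral_quotientMeasure_eq_self_of_forall_conj_eq`, cited by name
  (`GL2.orbitalIntegral_indicator_glInt_scalar_eq_one`).

## References

* J. D. Rogawski, *Automorphic Representations of Unitary Groups in Three Variables* (1990), §4.13,
  Lemma 4.13.1 (a), pp. 69–70 [Rogawski1990].
* S. Gelbart, *Automorphic forms on adele groups* (1975), Thm. 9.22 (iii), Remark 9.23 p. 140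
  [Gelbart1975].
* G. Laumon, *Cohomology of Drinfeld Modular Varieties* I (1996), Prop. (4.3.11) p. 83, Lemma (5.3.2)
  [Laumon1995].
-/

noncomputable section

open MeasureTheory MeasureTheory.Measure Topology Filter Matrix ValuativeRel
open scoped NNReal ENNReal MatrixGroups

namespace Literature.NumberTheory.Automorphic

open Literature.MeasureTheory.Group
open Literature.NumberTheory.GaloisRepresentations.IsNonarchimedeanLocalField

/-! ### §1 Algebra in `GL₂(𝒪)`: unipotents, units of the torus, `K·A ∩ N = N(𝒪)` -/

section Integral

variable {F : Type*} [Field F] [ValuativeRel F]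

omit [ValuativeRel F] in
/-- The matrix of `d(a, b) · n(x)` is `(a, a x; 0, b)`. [folklore] -/
private theorem GL2.coe_diagGL2_mul_unipotentGL2 (a b : Fˣ) (x : F) :
    ((diagGL2 a b * ((unipotentGL2 x : ↥(upperUnitriangular (Fin 2) F)) : GL (Fin 2) F) : GL (Fin 2) F) :
        Matrix (Fin 2) (Fin 2) F) = !![(a : F), (a : F) * x; 0, (b : F)] := by
  rw [Units.val_mul, coe_diagGL2, coe_unipotentGL2]
  ext i j
  fin_cases i <;> fin_cases j <;> simp [Matrix.mul_apply, Fin.sum_univ_two]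

omit [ValuativeRel F] in
/-- The matrix of `n(x) · d(a, b)` is `(a, x b; 0, b)`. [folklore] -/
private theorem GL2.coe_unipotentGL2_mul_diagGL2 (a b : Fˣ) (x : F) :
    ((((unipotentGL2 x : ↥(upperUnitriangular (Fin 2) F)) : GL (Fin 2) F) * diagGL2 a b : GL (Fin 2) F) :
        Matrix (Fin 2) (Fin 2) F) = !![(a : F), x * (b : F); 0, (b : F)] := by
  rw [Units.val_mul, coe_diagGL2, coe_unipotentGL2]
  ext i j
  fin_cases i <;> fin_cases j <;> simp [Matrix.mul_apply, Fin.sum_univ_two]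

/-- **`n(x) ∈ GL₂(𝒪) ↔ x ∈ 𝒪`** (`n(x) = (1 x; 0 1)`, `n(x)⁻¹ = n(−x)`). [cite: Rogawski1990, §4.13 p. 70] -/
theorem GL2.unipotentGL2_mem_glInt_iff (x : F) :
    ((unipotentGL2 x : ↥(upperUnitriangular (Fin 2) F)) : GL (Fin 2) F) ∈ glInt 2 F ↔ x ∈ 𝒪[F] := by
  rw [mem_glInt_iff, GL2.coe_unipotentGL2_inv, coe_unipotentGL2, coe_unipotentGL2]
  constructor
  · rintro ⟨h, -⟩
    simpa using h 0 1
  · intro hx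
    refine ⟨fun i j => ?_, fun i j => ?_⟩
    · fin_cases i <;> fin_cases j <;> simp [hx, one_mem, zero_mem]
    · fin_cases i <;> fin_cases j <;> simp [neg_mem hx, one_mem, zero_mem]

/-- **`d(a, b) ∈ GL₂(𝒪)` for units `a, b` of `𝒪`** (`a, a⁻¹, b, b⁻¹ ∈ 𝒪`). [cite: Rogawski1990, §4.13 p. 70] -/
theorem GL2.diagGL2_mem_glInt {a b : Fˣ} (ha : (a : F) ∈ 𝒪[F]) (ha' : ((a⁻¹ : Fˣ) : F) ∈ 𝒪[F])
    (hb : (b : F) ∈ 𝒪[F]) (hb' : ((b⁻¹ : Fˣ) : F) ∈ 𝒪[F]) : diagGL2 a b ∈ glInt 2 F := by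
  have ha'' : ((a : F))⁻¹ ∈ 𝒪[F] := by rwa [Units.val_inv_eq_inv_val] at ha'
  have hb'' : ((b : F))⁻¹ ∈ 𝒪[F] := by rwa [Units.val_inv_eq_inv_val] at hb'
  rw [mem_glInt_iff, diagGL2_inv, coe_diagGL2, coe_diagGL2]
  refine ⟨fun i j => ?_, fun i j => ?_⟩
  · fin_cases i <;> fin_cases j <;> simp [ha, hb, zero_mem]
  · fin_cases i <;> fin_cases j <;> simp [ha'', hb'', zero_mem]

/-- **`n(x) ∈ GL₂(𝒪) · A ↔ x ∈ 𝒪`** for the diagonal torus `A = C(d(m₀, m₁))`, `m₀ ≠ m₁`: if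
`n(x) = k a` with `a = d(s, t)` then `k = n(x) d(s, t)⁻¹ = (s⁻¹, x t⁻¹; 0, t⁻¹) ∈ GL₂(𝒪)` forces
`t, x t⁻¹ ∈ 𝒪`, so `x ∈ 𝒪` — the fibre of `π(K) ⊆ G ⧸ A` in the coordinates `(k, n) ↦ k n A`.
[cite: Rogawski1990, §4.13 p. 70] -/
theorem GL2.exists_glInt_centralizer_eq_unipotentGL2_iff {m₀ m₁ : Fˣ} (h : m₀ ≠ m₁) (x : F) :
    (∃ k ∈ glInt 2 F, ∃ a ∈ Subgroup.centralizer ({diagGL2 m₀ m₁} : Set (GL (Fin 2) F)),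
      ((unipotentGL2 x : ↥(upperUnitriangular (Fin 2) F)) : GL (Fin 2) F) = k * a) ↔ x ∈ 𝒪[F] := by
  constructor
  · rintro ⟨k, hk, a, ha, hx⟩
    obtain ⟨s, t, rfl⟩ := (GL2.mem_centralizer_diagGL2_iff h a).1 ha
    have hk' : ((unipotentGL2 x : ↥(upperUnitriangular (Fin 2) F)) : GL (Fin 2) F) * diagGL2 s⁻¹ t⁻¹ = k := by
      rw [hx, ← diagGL2_inv, mul_inv_cancel_right]
    rw [← hk', mem_glInt_iff] at hk
    obtain ⟨h1, h2⟩ := hk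
    -- the `(0,1)` entry of `k` and the `(1,1)` entry of `k⁻¹`
    have h01 := h1 0 1
    have h11 := h2 1 1
    rw [GL2.coe_unipotentGL2_mul_diagGL2] at h01
    rw [_root_.mul_inv_rev, diagGL2_inv, inv_inv, inv_inv, GL2.coe_unipotentGL2_inv,
      GL2.coe_diagGL2_mul_unipotentGL2] at h11
    simp only [Matrix.of_apply, Matrix.cons_val', Matrix.cons_val_one, Matrix.cons_val_fin_one,
      Matrix.cons_val_zero] at h01 h11
    have : x = x * ((t⁻¹ : Fˣ) : F) * (t : F) := by
      rw [Units.val_inv_eq_inv_val, inv_mul_cancel_right₀ t.ne_zero]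
    rw [this]
    exact mul_mem h01 h11
  · intro hx
    exact ⟨_, (GL2.unipotentGL2_mem_glInt_iff x).2 hx, 1, Subgroup.one_mem _, (mul_one _).symm⟩

end Integral

section NormAbs

variable {F : Type*} [Field F] [ValuativeRel F] [TopologicalSpace F] [IsNonarchimedeanLocalField F]

/-- A unit of `𝒪` has `|m|_F = 1 → m, m⁻¹ ∈ 𝒪`. [cite: Rogawski1990, §4.13 p. 70] -/
theorem GL2.mem_integer_of_normAbs_eq_one {m : Fˣ} (hm : normAbs F (m : F) = 1) :
    (m : F) ∈ 𝒪[F] ∧ ((m⁻¹ : Fˣ) : F) ∈ 𝒪[F] := by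
  refine ⟨normAbs_le_one_iff.1 hm.le, normAbs_le_one_iff.1 ?_⟩
  rw [Units.val_inv_eq_inv_val, map_inv₀, hm, inv_one]

omit [ValuativeRel F] [TopologicalSpace F] [IsNonarchimedeanLocalField F] in
/-- `c = m₀⁻¹ m₁ − 1 ≠ 0` for `m₀ ≠ m₁`. [cite: Gelbart1975, Remark 9.23 p. 140] -/
theorem GL2.inv_mul_sub_one_ne_zero {m₀ m₁ : Fˣ} (h : m₀ ≠ m₁) :
    ((m₀⁻¹ : Fˣ) : F) * m₁ - 1 ≠ 0 := by
  intro h0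
  apply h
  have h1 : ((m₀⁻¹ : Fˣ) : F) * m₁ = 1 := sub_eq_zero.1 h0
  have : (m₁ : F) = m₀ := by
    have := congrArg (fun t => (m₀ : F) * t) h1
    simpa [← mul_assoc] using this
  exact Units.ext this.symm

/-- **`‖m₀⁻¹ m₁ − 1‖ = ‖m₀ − m₁‖` for a unit `m₀` of `𝒪`** (`m₀⁻¹ m₁ − 1 = m₀⁻¹ (m₁ − m₀)`): the
Jacobian of (g2-i) is `‖m₀ − m₁‖⁻¹ = |D_{G/A}(γ)|^{-1/2}` at units. [cite: Rogawski1990, §4.13 p. 70] -/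
theorem GL2.normAbs_inv_mul_sub_one {m₀ : Fˣ} (hm₀ : normAbs F (m₀ : F) = 1) (m₁ : Fˣ) :
    normAbs F (((m₀⁻¹ : Fˣ) : F) * m₁ - 1) = normAbs F ((m₀ : F) - m₁) := by
  have h1 : ((m₀⁻¹ : Fˣ) : F) * m₁ - 1 = ((m₀⁻¹ : Fˣ) : F) * ((m₁ : F) - m₀) := by
    rw [mul_sub, Units.inv_mul]
  rw [h1, map_mul, Units.val_inv_eq_inv_val, map_inv₀, hm₀, inv_one, one_mul, ← normAbs_neg, neg_sub]

end NormAbs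

/-! ### §2 (g2-i) The `K N A` form of the split-torus orbital integral and the pinned constant -/

section Orbital

variable {F : Type*} [Field F] [ValuativeRel F] [TopologicalSpace F] [IsNonarchimedeanLocalField F]
  [SecondCountableTopology F] [MeasurableSpace F] [BorelSpace F]
  [MeasurableSpace (GL (Fin 2) F)] [BorelSpace (GL (Fin 2) F)] [SecondCountableTopology (GL (Fin 2) F)]

/-- **(g2-i) The split-torus orbital integral of `GL₂(F)` in `K N` coordinates, with its constant
pinned.** Let `γ = d(m₀, m₁)`, `m₀ ≠ m₁`, `A = C(γ)` the diagonal torus, `μ_q ≠ 0` a `GL₂(F)`-invariant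
measure on `GL₂(F) ⧸ A` finite on compact sets, `κ` a Haar measure on `K = GL₂(𝒪)` and `dx` an
additive Haar measure on `F`. There is `C > 0` such that
(1) **`C · κ(K) · dx(𝒪) = μ_q(π(K))`** and
(2) for every continuous compactly supported `f : GL₂(F) → E`,
**`O_γ^{μ_q}(f) = (C ‖m₀⁻¹ m₁ − 1‖⁻¹) · ∫_{K × F} f(k γ n(x) k⁻¹) d(κ ⊗ dx)`**
— the `K N A` integration formula (Gelbart, Remark 9.23: `∫_{A\G} = ∫_N ∫_K`), the conjugation
`n(x) γ n(x)⁻¹ = γ n((m₀⁻¹m₁ − 1) x)` and the substitution `x ↦ (m₀⁻¹m₁ − 1) x`; Rogawski's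
`Φ^G(γ, f) = |D_{G/M}(γ)|^{-1/2} Φ^M(γ, f̄^P)` for `G = GL₂ ⊃ M = A`.
[cite: Rogawski1990, §4.13 Lemma 4.13.1 (a) pp. 69–70] [cite: Gelbart1975, Remark 9.23 p. 140] -/
theorem GL2.exists_orbitalIntegral_diagGL2_eq_smul_integral {m₀ m₁ : Fˣ} (h : m₀ ≠ m₁)
    [MeasurableSpace (GL (Fin 2) F ⧸ Subgroup.centralizer ({diagGL2 m₀ m₁} : Set (GL (Fin 2) F)))]
    [BorelSpace (GL (Fin 2) F ⧸ Subgroup.centralizer ({diagGL2 m₀ m₁} : Set (GL (Fin 2) F)))]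
    (μq : Measure (GL (Fin 2) F ⧸ Subgroup.centralizer ({diagGL2 m₀ m₁} : Set (GL (Fin 2) F))))
    [SMulInvariantMeasure (GL (Fin 2) F) _ μq] [IsFiniteMeasureOnCompacts μq] (hμ : μq ≠ 0)
    (κ : Measure ↥(glInt 2 F)) [IsHaarMeasure κ] (dx : Measure F) [dx.IsAddHaarMeasure]
    {E : Type*} [NormedAddCommGroup E] [NormedSpace ℝ E] [CompleteSpace E] :
    ∃ C : ℝ≥0, C ≠ 0 ∧
      (C : ℝ≥0∞) * (κ Set.univ * dx (𝒪[F] : Set F)) =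
        μq ((QuotientGroup.mk : GL (Fin 2) F → _) '' (glInt 2 F : Set (GL (Fin 2) F))) ∧
      ∀ f : GL (Fin 2) F → E, Continuous f → HasCompactSupport f →
        orbitalIntegral (diagGL2 m₀ m₁) f μq =
          ((C * (normAbs F (((m₀⁻¹ : Fˣ) : F) * m₁ - 1))⁻¹ : ℝ≥0) : ℝ) •
            ∫ p : ↥(glInt 2 F) × F, f ((p.1 : GL (Fin 2) F) * diagGL2 m₀ m₁ *
              ((unipotentGL2 p.2 : ↥(upperUnitriangular (Fin 2) F)) : GL (Fin 2) F) *
                (p.1 : GL (Fin 2) F)⁻¹) ∂(κ.prod dx) := by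
  haveI : T2Space F := (GaloisRepresentations.IsNonarchimedeanLocalField.isLocalField F).toT2Space
  haveI : LocallyCompactSpace F :=
    (GaloisRepresentations.IsNonarchimedeanLocalField.isLocalField F).toLocallyCompactSpace
  haveI : T2Space (GL (Fin 2) F) := t2Space_generalLinearGroup F 2
  haveI : LocallyCompactSpace (GL (Fin 2) F) := locallyCompactSpace_generalLinearGroup F 2
  -- the subgroups `K = GL₂(𝒪)`, `A = C(γ)`, `N = N₂`, `B`
  have hK : IsCompact ((glInt 2 F : Subgroup (GL (Fin 2) F)) : Set (GL (Fin 2) F)) := isCompact_glInt 2 F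
  have hA : IsClosed ((Subgroup.centralizer ({diagGL2 m₀ m₁} : Set (GL (Fin 2) F)) : Subgroup (GL (Fin 2) F)) :
      Set (GL (Fin 2) F)) := Set.isClosed_centralizer _
  have hB : IsClosed ((standardParabolicGL F (id : Fin 2 → Fin 2) : Subgroup (GL (Fin 2) F)) : Set (GL (Fin 2) F)) :=
    isClosed_standardParabolicGL_id
  have hAB := GL2.centralizer_diagGL2_le_borel (F := F) h
  have hNB : upperUnitriangular (Fin 2) F ≤ standardParabolicGL F (id : Fin 2 → Fin 2) :=
    upperUnitriangular_le_standardParabolicGL_fin_two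
  have hAN := GL2.conj_mem_upperUnitriangular_of_mem_centralizer (F := F) h
  have hKB := GL2.exists_glInt_mul_borel (F := F)
  -- instances on the subgroup types
  haveI : BorelSpace ↥(Subgroup.centralizer ({diagGL2 m₀ m₁} : Set (GL (Fin 2) F))) := Subtype.borelSpace _
  haveI : BorelSpace ↥(upperUnitriangular (Fin 2) F) := Subtype.borelSpace _
  haveI : BorelSpace ↥(glInt 2 F) := Subtype.borelSpace _
  haveI : LocallyCompactSpace ↥(Subgroup.centralizer ({diagGL2 m₀ m₁} : Set (GL (Fin 2) F))) :=
    hA.locallyCompactSpace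
  haveI : CompactSpace ↥(glInt 2 F) := isCompact_iff_compactSpace.1 hK
  haveI : IsFiniteMeasure κ := CompactSpace.isFiniteMeasure
  haveI : SecondCountableTopology ↥(Subgroup.centralizer ({diagGL2 m₀ m₁} : Set (GL (Fin 2) F))) :=
    TopologicalSpace.Subtype.secondCountableTopology _
  haveI : SecondCountableTopology ↥(upperUnitriangular (Fin 2) F) := TopologicalSpace.Subtype.secondCountableTopology _
  haveI : SecondCountableTopology ↥(glInt 2 F) := TopologicalSpace.Subtype.secondCountableTopology _
  haveI : BorelSpace (↥(glInt 2 F) × ↥(upperUnitriangular (Fin 2) F)) := Prod.borelSpace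
  haveI : BorelSpace (↥(glInt 2 F) × F) := Prod.borelSpace
  -- the torus is abelian
  letI : CommGroup ↥(Subgroup.centralizer ({diagGL2 m₀ m₁} : Set (GL (Fin 2) F))) :=
    { (inferInstance : Group ↥(Subgroup.centralizer ({diagGL2 m₀ m₁} : Set (GL (Fin 2) F)))) with
      mul_comm := fun x y => Subtype.ext (by
        obtain ⟨a, b, hx⟩ := (GL2.mem_centralizer_diagGL2_iff h (x : GL (Fin 2) F)).1 x.2
        obtain ⟨a', b', hy⟩ := (GL2.mem_centralizer_diagGL2_iff h (y : GL (Fin 2) F)).1 y.2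
        change (x : GL (Fin 2) F) * y = y * x
        rw [hx, hy]
        exact GL2.diagGL2_mul_comm _ _ _ _) }
  -- the measures
  haveI : (haar : Measure (GL (Fin 2) F)).IsMulRightInvariant := isMulRightInvariant_generalLinearGroup _
  haveI : (haar : Measure (GL (Fin 2) F)).IsInvInvariant := isInvInvariant_of_isMulRightInvariant _
  haveI : dx.Regular := regular_of_isAddHaarMeasure dx
  haveI : dx.IsNegInvariant := inferInstance
  haveI := GL2.isHaarMeasure_map_unipotentGL2 dx
  haveI := GL2.isInvInvariant_map_unipotentGL2 dx
  haveI : (haar : Measure ↥(Subgroup.centralizer ({diagGL2 m₀ m₁} : Set (GL (Fin 2) F)))).IsInvInvariant :=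
    inferInstance
  obtain ⟨C, hC0, hμC⟩ := exists_measure_quotient_eq_smul_map hK hA hB hAB hNB hAN (GL2.torusBorelHomeomorph h)
    (GL2.torusBorelHomeomorph_eq_anMap h) hKB haar κ haar
    (Measure.map (unipotentGL2 : F → ↥(upperUnitriangular (Fin 2) F)) dx) μq hμ
  have hm : Measurable fun p : ↥(glInt 2 F) × ↥(upperUnitriangular (Fin 2) F) =>
      (QuotientGroup.mk ((p.1 : GL (Fin 2) F) * (p.2 : GL (Fin 2) F)) :
        GL (Fin 2) F ⧸ Subgroup.centralizer ({diagGL2 m₀ m₁} : Set (GL (Fin 2) F))) :=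
    ((QuotientGroup.continuous_mk (N := Subgroup.centralizer ({diagGL2 m₀ m₁} : Set (GL (Fin 2) F)))).comp
      ((continuous_subtype_val.comp continuous_fst).mul
      (continuous_subtype_val.comp continuous_snd))).measurable
  -- the coordinate `x ↦ n(x)` as a measurable equivalence `F ≃ᵐ N₂`
  set eN : F ≃ᵐ ↥(upperUnitriangular (Fin 2) F) := (unipotentHomeomorphGL2 (R := F)).toMeasurableEquiv
    with heN
  have heN_coe : (⇑eN : F → ↥(upperUnitriangular (Fin 2) F)) = unipotentGL2 := rfl
  refine ⟨C, hC0, ?_, fun f hfc hfs => ?_⟩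
  · -- (1) the mass of `π(K)`: its preimage in `K × N` is `K × {n | n ∈ K·A}` = `K × n(𝒪)`
    have hKopen : IsOpen ((glInt 2 F : Subgroup (GL (Fin 2) F)) : Set (GL (Fin 2) F)) := isOpen_glInt 2 F
    have hπK : MeasurableSet ((QuotientGroup.mk : GL (Fin 2) F → GL (Fin 2) F ⧸
        Subgroup.centralizer ({diagGL2 m₀ m₁} : Set (GL (Fin 2) F))) '' (glInt 2 F : Set (GL (Fin 2) F))) :=
      (QuotientGroup.isOpenMap_coe _ hKopen).measurableSet
    have hpre : (fun p : ↥(glInt 2 F) × ↥(upperUnitriangular (Fin 2) F) =>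
        (QuotientGroup.mk ((p.1 : GL (Fin 2) F) * (p.2 : GL (Fin 2) F)) :
          GL (Fin 2) F ⧸ Subgroup.centralizer ({diagGL2 m₀ m₁} : Set (GL (Fin 2) F)))) ⁻¹'
        ((QuotientGroup.mk : GL (Fin 2) F → _) '' (glInt 2 F : Set (GL (Fin 2) F))) =
        (Set.univ : Set ↥(glInt 2 F)) ×ˢ
          (eN '' (𝒪[F] : Set F)) := by
      ext ⟨k, n⟩
      simp only [Set.mem_preimage, Set.mem_image, Set.mem_prod, Set.mem_univ, true_and, SetLike.mem_coe]
      constructor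
      · rintro ⟨k', hk', hkk'⟩
        -- `k'⁻¹ (k n) ∈ A`, so `n = (k⁻¹ k') a` with `a ∈ A`
        have ha : k'⁻¹ * ((k : GL (Fin 2) F) * (n : GL (Fin 2) F)) ∈
            Subgroup.centralizer ({diagGL2 m₀ m₁} : Set (GL (Fin 2) F)) := QuotientGroup.eq.1 hkk'
        obtain ⟨x, hx⟩ : ∃ x, unipotentGL2 x = n := ⟨_, unipotentGL2_entry n⟩
        refine ⟨x, ?_, by rw [heN_coe, hx]⟩
        refine (GL2.exists_glInt_centralizer_eq_unipotentGL2_iff h x).1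
          ⟨(k : GL (Fin 2) F)⁻¹ * k', (glInt 2 F).mul_mem ((glInt 2 F).inv_mem k.2) hk', _, ha, ?_⟩
        rw [hx]
        group
      · rintro ⟨x, hx, hxn⟩
        obtain ⟨k', hk', a, ha, hxe⟩ := (GL2.exists_glInt_centralizer_eq_unipotentGL2_iff h x).2 hx
        refine ⟨(k : GL (Fin 2) F) * k', (glInt 2 F).mul_mem k.2 hk', ?_⟩
        rw [QuotientGroup.eq, ← hxn, heN_coe]
        change ((k : GL (Fin 2) F) * k')⁻¹ * ((k : GL (Fin 2) F) *
          ((unipotentGL2 x : ↥(upperUnitriangular (Fin 2) F)) : GL (Fin 2) F)) ∈ _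
        rw [hxe]
        have : ((k : GL (Fin 2) F) * k')⁻¹ * ((k : GL (Fin 2) F) * (k' * a)) = a := by group
        rw [this]
        exact ha
    rw [hμC, Measure.smul_apply, Measure.map_apply hm hπK, hpre, Measure.prod_prod,
      ← heN_coe, MeasurableEquiv.map_apply, eN.preimage_image, ENNReal.smul_def, smul_eq_mul]
  · -- (2) the orbital integral in `K N` coordinates
    have hφ : StronglyMeasurable (descConj (diagGL2 m₀ m₁)
        (Subgroup.centralizer ({diagGL2 m₀ m₁} : Set (GL (Fin 2) F)))
        (fun _ hg => Subgroup.mem_centralizer_singleton_iff.1 hg) f) :=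
      (continuous_descConj _ _ _ hfc).stronglyMeasurable
    rw [orbitalIntegral_eq_integral_descConj, integral_quotient_eq_smul_integral_prod κ
      (Measure.map (unipotentGL2 : F → ↥(upperUnitriangular (Fin 2) F)) dx) μq hμC _ hφ]
    simp only [descConj_mk]
    -- pass from `K × N₂` to `K × F` along `n`
    set e : ↥(glInt 2 F) × F ≃ᵐ ↥(glInt 2 F) × ↥(upperUnitriangular (Fin 2) F) :=
      MeasurableEquiv.prodCongr (MeasurableEquiv.refl _) eN with he
    have hprod : κ.prod (Measure.map (unipotentGL2 : F → ↥(upperUnitriangular (Fin 2) F)) dx) =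
        Measure.map e (κ.prod dx) := by
      rw [← heN_coe, show (⇑e : ↥(glInt 2 F) × F → _) = Prod.map id eN from rfl,
        ← Measure.map_prod_map κ dx measurable_id eN.measurable, Measure.map_id]
    rw [hprod, integral_map_equiv]
    -- the conjugation formula `(k n(x)) γ (k n(x))⁻¹ = k (γ n(c x)) k⁻¹`
    have hconj : ∀ p : ↥(glInt 2 F) × F,
        f (((e p).1 : GL (Fin 2) F) * ((e p).2 : GL (Fin 2) F) * diagGL2 m₀ m₁ *
            (((e p).1 : GL (Fin 2) F) * ((e p).2 : GL (Fin 2) F))⁻¹) =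
        (fun q : ↥(glInt 2 F) × F => f ((q.1 : GL (Fin 2) F) * diagGL2 m₀ m₁ *
            ((unipotentGL2 q.2 : ↥(upperUnitriangular (Fin 2) F)) : GL (Fin 2) F) * (q.1 : GL (Fin 2) F)⁻¹))
          (p.1, (((m₀⁻¹ : Fˣ) : F) * m₁ - 1) * p.2) := by
      intro p
      change f ((p.1 : GL (Fin 2) F) * ((unipotentGL2 p.2 : ↥(upperUnitriangular (Fin 2) F)) : GL (Fin 2) F) *
          diagGL2 m₀ m₁ * ((p.1 : GL (Fin 2) F) *
            ((unipotentGL2 p.2 : ↥(upperUnitriangular (Fin 2) F)) : GL (Fin 2) F))⁻¹) = _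
      simp only
      rw [_root_.mul_inv_rev, show (p.1 : GL (Fin 2) F) *
          ((unipotentGL2 p.2 : ↥(upperUnitriangular (Fin 2) F)) : GL (Fin 2) F) * diagGL2 m₀ m₁ *
          ((((unipotentGL2 p.2 : ↥(upperUnitriangular (Fin 2) F)) : GL (Fin 2) F))⁻¹ * (p.1 : GL (Fin 2) F)⁻¹) =
        (p.1 : GL (Fin 2) F) * (((unipotentGL2 p.2 : ↥(upperUnitriangular (Fin 2) F)) : GL (Fin 2) F) *
          diagGL2 m₀ m₁ * (((unipotentGL2 p.2 : ↥(upperUnitriangular (Fin 2) F)) : GL (Fin 2) F))⁻¹) *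
          (p.1 : GL (Fin 2) F)⁻¹ by simp only [mul_assoc], GL2.unipotentGL2_mul_diagGL2_mul_inv, ← mul_assoc]
    simp_rw [hconj]
    -- the substitution `x ↦ c x`, `c = m₀⁻¹ m₁ - 1 ≠ 0`, with Jacobian `‖c‖⁻¹`
    have hc : ((m₀⁻¹ : Fˣ) : F) * m₁ - 1 ≠ 0 := GL2.inv_mul_sub_one_ne_zero h
    set ec : ↥(glInt 2 F) × F ≃ᵐ ↥(glInt 2 F) × F :=
      MeasurableEquiv.prodCongr (MeasurableEquiv.refl _) (MeasurableEquiv.mulLeft₀ _ hc) with hec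
    have hec_coe : (⇑ec : ↥(glInt 2 F) × F → _) = fun p => (p.1, (((m₀⁻¹ : Fˣ) : F) * m₁ - 1) * p.2) := rfl
    have hmap : Measure.map ec (κ.prod dx) =
        ((normAbs F (((m₀⁻¹ : Fˣ) : F) * m₁ - 1)⁻¹ : ℝ≥0) : ℝ≥0∞) • κ.prod dx := by
      rw [show (⇑ec : ↥(glInt 2 F) × F → _) = Prod.map id (fun x => (((m₀⁻¹ : Fˣ) : F) * m₁ - 1) * x) from rfl,
        ← Measure.map_prod_map κ dx measurable_id (measurable_const_mul _), Measure.map_id,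
        map_mul_left_addHaar dx hc, Measure.prod_smul_right]
    -- name the integrand and substitute
    set G : ↥(glInt 2 F) × F → E := fun q : ↥(glInt 2 F) × F => f ((q.1 : GL (Fin 2) F) * diagGL2 m₀ m₁ *
        ((unipotentGL2 q.2 : ↥(upperUnitriangular (Fin 2) F)) : GL (Fin 2) F) * (q.1 : GL (Fin 2) F)⁻¹) with hG
    have h1 : (fun p : ↥(glInt 2 F) × F => G (p.1, (((m₀⁻¹ : Fˣ) : F) * m₁ - 1) * p.2)) =
        fun p => G (ec p) := by
      funext p
      rw [hec_coe]
    rw [h1, ← integral_map_equiv ec G, hmap, integral_smul_measure, ENNReal.coe_toReal]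
    simp only [NNReal.smul_def, smul_smul, map_inv₀, NNReal.coe_mul, NNReal.coe_inv]

/-! ### §3 (g2-ii) The unit element: `O_γ(1_K) = vol(π K) ∕ ‖m₀ − m₁‖` -/

omit [SecondCountableTopology F] [MeasurableSpace F] [BorelSpace F] [MeasurableSpace (GL (Fin 2) F)]
  [BorelSpace (GL (Fin 2) F)] [SecondCountableTopology (GL (Fin 2) F)] in
/-- `1_K(k g k⁻¹) = 1_K(g)` for `k ∈ K`, and `1_K(γ n(x)) = 1_𝒪(x)` for `γ = d(m₀, m₁)` with unit
entries: the integrand of (g2-i) at `f = 1_K` is the indicator of `K × 𝒪`. [cite: Rogawski1990, §4.13 p. 70] -/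
theorem GL2.indicator_glInt_conj_diagGL2_mul_unipotentGL2 {m₀ m₁ : Fˣ} (hm₀ : normAbs F (m₀ : F) = 1)
    (hm₁ : normAbs F (m₁ : F) = 1) (k : ↥(glInt 2 F)) (x : F) :
    ((glInt 2 F : Subgroup (GL (Fin 2) F)) : Set (GL (Fin 2) F)).indicator (1 : GL (Fin 2) F → ℝ)
        ((k : GL (Fin 2) F) * diagGL2 m₀ m₁ *
          ((unipotentGL2 x : ↥(upperUnitriangular (Fin 2) F)) : GL (Fin 2) F) * (k : GL (Fin 2) F)⁻¹) =
      (𝒪[F] : Set F).indicator (1 : F → ℝ) x := by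
  have hd : diagGL2 m₀ m₁ ∈ glInt 2 F :=
    GL2.diagGL2_mem_glInt (GL2.mem_integer_of_normAbs_eq_one hm₀).1 (GL2.mem_integer_of_normAbs_eq_one hm₀).2
      (GL2.mem_integer_of_normAbs_eq_one hm₁).1 (GL2.mem_integer_of_normAbs_eq_one hm₁).2
  have hiff : (k : GL (Fin 2) F) * diagGL2 m₀ m₁ *
      ((unipotentGL2 x : ↥(upperUnitriangular (Fin 2) F)) : GL (Fin 2) F) * (k : GL (Fin 2) F)⁻¹ ∈
        ((glInt 2 F : Subgroup (GL (Fin 2) F)) : Set (GL (Fin 2) F)) ↔ x ∈ (𝒪[F] : Set F) := by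
    rw [SetLike.mem_coe, Subgroup.mul_mem_cancel_right _ ((glInt 2 F).inv_mem k.2), mul_assoc,
      Subgroup.mul_mem_cancel_left _ k.2, Subgroup.mul_mem_cancel_left _ hd, GL2.unipotentGL2_mem_glInt_iff]
    rfl
  by_cases hx : x ∈ (𝒪[F] : Set F)
  · rw [Set.indicator_of_mem hx, Set.indicator_of_mem (hiff.2 hx), Pi.one_apply, Pi.one_apply]
  · rw [Set.indicator_of_notMem hx, Set.indicator_of_notMem (fun h' => hx (hiff.1 h'))]

/-- **(g2-ii, any invariant measure) `O_γ^{μ_q}(1_K) = μ_q(π(K)) · ‖m₀ − m₁‖⁻¹`** for `γ = d(m₀, m₁)`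
with `m₀ ≠ m₁` units of `𝒪` and any non-zero `GL₂(F)`-invariant Radon measure `μ_q` on `GL₂(F) ⧸ A`:
(g2-i) at `f = 1_K` (continuous: `K` is clopen), the inner integrand being `1_𝒪(x)`
(`∫_N 1_K(γ n) dn = dx(𝒪)`), and the pinned constant `C κ(K) dx(𝒪) = μ_q(π K)`.
[cite: Rogawski1990, §4.13 Lemma 4.13.1 (a) pp. 69–70] -/
theorem GL2.orbitalIntegral_indicator_glInt_diagGL2 {m₀ m₁ : Fˣ} (h : m₀ ≠ m₁)
    (hm₀ : normAbs F (m₀ : F) = 1) (hm₁ : normAbs F (m₁ : F) = 1)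
    [MeasurableSpace (GL (Fin 2) F ⧸ Subgroup.centralizer ({diagGL2 m₀ m₁} : Set (GL (Fin 2) F)))]
    [BorelSpace (GL (Fin 2) F ⧸ Subgroup.centralizer ({diagGL2 m₀ m₁} : Set (GL (Fin 2) F)))]
    (μq : Measure (GL (Fin 2) F ⧸ Subgroup.centralizer ({diagGL2 m₀ m₁} : Set (GL (Fin 2) F))))
    [SMulInvariantMeasure (GL (Fin 2) F) _ μq] [IsFiniteMeasureOnCompacts μq] (hμ : μq ≠ 0) :
    orbitalIntegral (diagGL2 m₀ m₁)
        (((glInt 2 F : Subgroup (GL (Fin 2) F)) : Set (GL (Fin 2) F)).indicator (1 : GL (Fin 2) F → ℝ)) μq =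
      (μq ((QuotientGroup.mk : GL (Fin 2) F → _) '' (glInt 2 F : Set (GL (Fin 2) F)))).toReal *
        ((normAbs F ((m₀ : F) - m₁))⁻¹ : ℝ≥0) := by
  haveI : T2Space F := (GaloisRepresentations.IsNonarchimedeanLocalField.isLocalField F).toT2Space
  haveI : LocallyCompactSpace F :=
    (GaloisRepresentations.IsNonarchimedeanLocalField.isLocalField F).toLocallyCompactSpace
  haveI : T2Space (GL (Fin 2) F) := t2Space_generalLinearGroup F 2
  haveI : LocallyCompactSpace (GL (Fin 2) F) := locallyCompactSpace_generalLinearGroup F 2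
  haveI : BorelSpace ↥(glInt 2 F) := Subtype.borelSpace _
  haveI : CompactSpace ↥(glInt 2 F) := isCompact_iff_compactSpace.1 (isCompact_glInt 2 F)
  haveI : IsFiniteMeasure (haar : Measure ↥(glInt 2 F)) := CompactSpace.isFiniteMeasure
  haveI : BorelSpace (↥(glInt 2 F) × F) := Prod.borelSpace
  obtain ⟨C, -, hpin, hint⟩ := GL2.exists_orbitalIntegral_diagGL2_eq_smul_integral h μq hμ
    (haar : Measure ↥(glInt 2 F)) (addHaar : Measure F) (E := ℝ)
  have hclopen : IsClopen ((glInt 2 F : Subgroup (GL (Fin 2) F)) : Set (GL (Fin 2) F)) :=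
    ⟨Subgroup.isClosed_of_isOpen _ (isOpen_glInt 2 F), isOpen_glInt 2 F⟩
  have hfc : Continuous (((glInt 2 F : Subgroup (GL (Fin 2) F)) : Set (GL (Fin 2) F)).indicator
      (1 : GL (Fin 2) F → ℝ)) := hclopen.continuous_indicator continuous_const
  have hfs : HasCompactSupport (((glInt 2 F : Subgroup (GL (Fin 2) F)) : Set (GL (Fin 2) F)).indicator
      (1 : GL (Fin 2) F → ℝ)) :=
    HasCompactSupport.intro (isCompact_glInt 2 F) fun g hg => Set.indicator_of_notMem hg _
  rw [hint _ hfc hfs]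
  simp_rw [GL2.indicator_glInt_conj_diagGL2_mul_unipotentGL2 hm₀ hm₁]
  have hO : MeasurableSet (𝒪[F] : Set F) := by
    have : (𝒪[F] : Set F) = primePowBall F 0 := by
      ext x
      exact (LocalFieldHaar.mem_primePowBall_zero_iff (F := F)).symm
    rw [this]
    exact measurableSet_primePowBall 0
  have hind : (fun p : ↥(glInt 2 F) × F => (𝒪[F] : Set F).indicator (1 : F → ℝ) p.2) =
      ((Set.univ : Set ↥(glInt 2 F)) ×ˢ (𝒪[F] : Set F)).indicator 1 := by
    funext p
    by_cases hp : p.2 ∈ (𝒪[F] : Set F)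
    · rw [Set.indicator_of_mem hp, Set.indicator_of_mem (Set.mk_mem_prod (Set.mem_univ _) hp)]
      rfl
    · rw [Set.indicator_of_notMem hp, Set.indicator_of_notMem]
      exact fun hp' => hp hp'.2
  rw [hind, integral_indicator_one (MeasurableSet.univ.prod hO), measureReal_def, Measure.prod_prod,
    GL2.normAbs_inv_mul_sub_one hm₀, smul_eq_mul, NNReal.coe_mul, ← hpin]
  simp only [ENNReal.toReal_mul, ENNReal.coe_toReal]
  ring

variable [T2Space (GL (Fin 2) F)] [LocallyCompactSpace (GL (Fin 2) F)] {m₀ m₁ : Fˣ}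
  [MeasurableSpace (GL (Fin 2) F ⧸ Subgroup.centralizer ({diagGL2 m₀ m₁} : Set (GL (Fin 2) F)))]
  [BorelSpace (GL (Fin 2) F ⧸ Subgroup.centralizer ({diagGL2 m₀ m₁} : Set (GL (Fin 2) F)))]
  [hA : IsClosed ((Subgroup.centralizer ({diagGL2 m₀ m₁} : Set (GL (Fin 2) F)) : Subgroup (GL (Fin 2) F)) :
    Set (GL (Fin 2) F))]
  (t : Measure ↥(Subgroup.centralizer ({diagGL2 m₀ m₁} : Set (GL (Fin 2) F)))) [t.IsMulLeftInvariant]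
  [IsFiniteMeasureOnCompacts t] [t.IsOpenPosMeasure] [t.IsInvInvariant] [SFinite t]
  (ν : Measure (GL (Fin 2) F)) [IsHaarMeasure ν] [ν.IsMulRightInvariant]

/-- **(g2-ii) The unit element for the quotient measure** (the point-set instances `T2Space` ∕
`LocallyCompactSpace (GL (Fin 2) F)` are the tree's ★ `t2Space_generalLinearGroup F 2` ∕
★ `locallyCompactSpace_generalLinearGroup F 2`, to be supplied by the consumer): for `γ = d(m₀, m₁)` with `m₀ ≠ m₁` units
of `𝒪`, `t` an inversion-invariant left Haar measure on the torus `A = C(γ)` and `ν` a two-sided Haar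
measure on `GL₂(F)`:
**`O_γ^{ν/t}(1_K) = (ν(K) ∕ t(A ∩ K)) · ‖m₀ − m₁‖⁻¹`** (`(ν/t)(π K) = ν(K)∕t(A ∩ K)` by
★ `quotientMeasure_image_mk_eq_div`). [cite: Rogawski1990, §4.13 Lemma 4.13.1 (a) pp. 69–70] -/
theorem GL2.orbitalIntegral_indicator_glInt_diagGL2_quotientMeasure (h : m₀ ≠ m₁)
    (hm₀ : normAbs F (m₀ : F) = 1) (hm₁ : normAbs F (m₁ : F) = 1) :
    orbitalIntegral (diagGL2 m₀ m₁)
        (((glInt 2 F : Subgroup (GL (Fin 2) F)) : Set (GL (Fin 2) F)).indicator (1 : GL (Fin 2) F → ℝ))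
        (quotientMeasure (Subgroup.centralizer ({diagGL2 m₀ m₁} : Set (GL (Fin 2) F))) t hA ν) =
      (ν (glInt 2 F : Set (GL (Fin 2) F)) /
          t (Subtype.val ⁻¹' ((glInt 2 F : Subgroup (GL (Fin 2) F)) : Set (GL (Fin 2) F)))).toReal *
        ((normAbs F ((m₀ : F) - m₁))⁻¹ : ℝ≥0) := by
  rw [GL2.orbitalIntegral_indicator_glInt_diagGL2 h hm₀ hm₁ _ (quotientMeasure_ne_zero _ t hA ν),
    quotientMeasure_image_mk_eq_div _ t ν (glInt 2 F) (isOpen_glInt 2 F) (isCompact_glInt 2 F)]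

/-- **(g2-ii, canonical measures) `O_γ^{ν/t}(1_K) = ‖m₀ − m₁‖⁻¹`** when `ν(K) = 1` and `t(A ∩ K) = 1`
(`vol GL₂(𝒪) = 1`, `vol A(𝒪) = 1`): the split regular orbital integral of the unit element of the
Hecke algebra (Laumon (1996), (4.3.11) with `f = 1_K`; Rogawski Lemma 4.13.1 (a)).
[cite: Rogawski1990, §4.13 Lemma 4.13.1 (a) pp. 69–70] [cite: Laumon1995, (4.3.11) p. 83] -/
theorem GL2.orbitalIntegral_indicator_glInt_diagGL2_quotientMeasure_of_measure_eq_one (h : m₀ ≠ m₁)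
    (hm₀ : normAbs F (m₀ : F) = 1) (hm₁ : normAbs F (m₁ : F) = 1)
    (hν : ν (glInt 2 F : Set (GL (Fin 2) F)) = 1)
    (ht : t (Subtype.val ⁻¹' ((glInt 2 F : Subgroup (GL (Fin 2) F)) : Set (GL (Fin 2) F))) = 1) :
    orbitalIntegral (diagGL2 m₀ m₁)
        (((glInt 2 F : Subgroup (GL (Fin 2) F)) : Set (GL (Fin 2) F)).indicator (1 : GL (Fin 2) F → ℝ))
        (quotientMeasure (Subgroup.centralizer ({diagGL2 m₀ m₁} : Set (GL (Fin 2) F))) t hA ν) =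
      ((normAbs F ((m₀ : F) - m₁))⁻¹ : ℝ≥0) := by
  rw [GL2.orbitalIntegral_indicator_glInt_diagGL2_quotientMeasure t ν h hm₀ hm₁, hν, ht, div_one,
    ENNReal.toReal_one, one_mul]

end Orbital

/-! ### §4 (g2-iii) The central element -/

section Central

variable {F : Type*} [Field F] [ValuativeRel F] [TopologicalSpace F] [IsNonarchimedeanLocalField F]
  [MeasurableSpace (GL (Fin 2) F)] [BorelSpace (GL (Fin 2) F)] [SecondCountableTopology (GL (Fin 2) F)]
  [T2Space (GL (Fin 2) F)] [LocallyCompactSpace (GL (Fin 2) F)] (z : GL (Fin 2) F)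
  [MeasurableSpace (GL (Fin 2) F ⧸ Subgroup.centralizer ({z} : Set (GL (Fin 2) F)))]
  [BorelSpace (GL (Fin 2) F ⧸ Subgroup.centralizer ({z} : Set (GL (Fin 2) F)))]
  [hC : IsClosed ((Subgroup.centralizer ({z} : Set (GL (Fin 2) F)) : Subgroup (GL (Fin 2) F)) : Set (GL (Fin 2) F))]
  (t : Measure ↥(Subgroup.centralizer ({z} : Set (GL (Fin 2) F)))) [t.IsMulLeftInvariant]
  [IsFiniteMeasureOnCompacts t] [t.IsOpenPosMeasure] [t.IsInvInvariant] [SFinite t]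
  (ν : Measure (GL (Fin 2) F)) [IsHaarMeasure ν] [ν.IsMulRightInvariant]

omit [SFinite t] in
/-- **(g2-iii) The central value**: for a CENTRAL `z ∈ GL₂(F)` lying in `K = GL₂(𝒪)` (a scalar unit),
with `ν(K) = 1` and `t(C(z) ∩ K) = t(K) = 1`: `O_z^{ν/t}(1_K) = 1_K(z) = 1` — ★ A-p13
`orbitalIntegral_quotientMeasure_eq_self_of_forall_conj_eq` (the orbital integrand is constant and
`(ν/t)(G ⧸ G) = 1`). [cite: Rogawski1990, §4.9 p. 54] -/
theorem GL2.orbitalIntegral_indicator_glInt_scalar_eq_one (hz : ∀ y : GL (Fin 2) F, y * z * y⁻¹ = z)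
    (hzK : z ∈ glInt 2 F) (hν : ν (glInt 2 F : Set (GL (Fin 2) F)) = 1)
    (ht : t {c : ↥(Subgroup.centralizer ({z} : Set (GL (Fin 2) F))) | (c : GL (Fin 2) F) ∈
      ((glInt 2 F : Subgroup (GL (Fin 2) F)) : Set (GL (Fin 2) F))} = 1) :
    orbitalIntegral z
        (((glInt 2 F : Subgroup (GL (Fin 2) F)) : Set (GL (Fin 2) F)).indicator (1 : GL (Fin 2) F → ℝ))
        (quotientMeasure (Subgroup.centralizer ({z} : Set (GL (Fin 2) F))) t hC ν) = 1 := by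
  rw [orbitalIntegral_quotientMeasure_eq_self_of_forall_conj_eq hz hC t ν (isOpen_glInt 2 F).measurableSet hν ht,
    Set.indicator_of_mem (show z ∈ ((glInt 2 F : Subgroup (GL (Fin 2) F)) : Set (GL (Fin 2) F)) from hzK),
    Pi.one_apply]

end Central

end Literature.NumberTheory.Automorphic
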